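import Literature.Geometry.Lorentzian.GerochMonotonicityGauss
import Literature.Geometry.Lorentzian.IMCFRegularity
import HarnessLib

/-!
# Geroch monotonicity from the evolution equation (1.3) and Gauss–Bonnet

`geroch_monotonicity_smooth_of_evolution` (`GerochMonotonicityGauss.lean`) reduces the named fact
`geroch_monotonicity_smooth` (Huisken–Ilmanen 2001, §5, Monotonicity Calculation, smooth case) to:
a jointly `C¹` representative of the mean curvature satisfying the evolution equation (1.3), and
the Gauss–Bonnet bound. The joint regularity is a theorem (`contDiffOn_meanCurvature_chart`,
`IMCFRegularity.lean`), so what remains is exactly (1.3) and Gauss–Bonnet: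

* `geroch_monotonicity_smooth_of_evolution'` — the fact follows once, for every classical
  solution with `R ≥ 0` and every `t ∈ (a, b)`, `y ∈ S`, the mean curvature `t ↦ H_t(y)` satisfies
  Huisken–Ilmanen's (1.3), `∂_t H = −Δ(H⁻¹) − (|A|² + Rc(ν,ν))/H`, and `∫_{N_t} R(g_t) dμ_t ≤ 8π`.

Everything is proved; there are no definitions and no named facts.

## References

* G. Huisken, T. Ilmanen, *The inverse mean curvature flow and the Riemannian Penrose
  inequality*, J. Differential Geom. 59 (2001) 353–437: §1, (1.3); §5, Monotonicity Calculation.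
-/

noncomputable section

open Bundle Set Manifold TopologicalSpace Filter MeasureTheory Function
open scoped ContDiff Topology Manifold Real

namespace Literature.Geometry.Lorentzian

open PseudoRiemannianMetric

/-- **`geroch_monotonicity_smooth` from (1.3) and Gauss–Bonnet.** The named fact follows from the
two inputs of the printed proof that the tree does not yet prove: for every classical solution of
inverse mean curvature flow by a compact connected surface in a Riemannian `3`-manifold with
`R ≥ 0` — (1.3) the evolution equation of the mean curvature, for some (equivalently, by the joint
smoothness `contDiffOn_meanCurvature_chart`, any) representative `Hf` of `H` on `(a, b)`:
`d/dt Hf(t, y) = −Δ_{g_t}(H⁻¹)(y) − (|A|²_{g_t}(y) + Rc_h(ν, ν)(F_t y))/H_t(y)` (Huisken–Ilmanen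
2001, §1, (1.3)); and (GB) `∫_{N_t} R(g_t) dμ_t ≤ 8π` (Gauss–Bonnet with `χ(N_t) ≤ 2`,
`R(g_t) = 2K`). Everything else of the Monotonicity Calculation — the first variation of area and
the differentiation of `∫ H² dμ_t` (`GerochMonotonicityVariation.lean`, `IMCFRegularity.lean`),
the Gauss equation (`GerochMonotonicityGauss.lean`), the integration by parts
(`GreenIdentity.lean`) and the final estimate (`GerochMonotonicityProofs.lean`) — is proved.
[cite: HuiskenIlmanenIMCF2001, §5 Monotonicity Calculation (smooth case)] -/
theorem geroch_monotonicity_smooth_of_evolution'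
    (hin : ∀ (X : Type) [TopologicalSpace X] [ChartedSpace E3 X] [IsManifold (𝓡 3) ∞ X]
      [T2Space X] [SecondCountableTopology X]
      (h : ContMDiffRiemannianMetric (𝓡 3) ∞ E3 (TangentSpace (𝓡 3) : X → Type _))
      [(ofRiemannian h).HasLeviCivita]
      (S : Type) [TopologicalSpace S] [ChartedSpace (EuclideanSpace ℝ (Fin 2)) S]
      [IsManifold (𝓡 2) ∞ S] [CompactSpace S] [T2Space S] [ConnectedSpace S]
      [MeasurableSpace S] [BorelSpace S]
      (hpb : contMDiff_pullbackBilin (𝓡 3) X (𝓡 2) S ∞)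
      (F : ℝ → S → X) (ν : (t : ℝ) → NormalField (𝓡 3) (F t)) (a b : ℝ)
      (Hc : IsClassicalIMCF h hpb F ν a b),
      (∀ x : X, 0 ≤ (ofRiemannian h).scalarCurvature x) →
      ∃ Hf : ℝ → S → ℝ,
        -- `Hf` is the mean curvature on `(a, b)` …
        (∀ t (ht : t ∈ Set.Ioo a b) (y : S), Hf t y =
          (ofRiemannian h).meanCurvature (F t) hpb (Hc.isSpacelikeImmersion t ht) (ν t) y) ∧
        -- … and satisfies the evolution equation (1.3)
        (∀ t (ht : t ∈ Set.Ioo a b) (y : S),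
          haveI := ((ofRiemannian h).inducedMetric (F t) hpb
            (Hc.isSpacelikeImmersion t ht)).hasLeviCivita
          deriv (fun t' ↦ Hf t' y) t =
          -((ofRiemannian h).inducedMetric (F t) hpb (Hc.isSpacelikeImmersion t ht)).dalembertian
              (fun z ↦ ((ofRiemannian h).meanCurvature (F t) hpb (Hc.isSpacelikeImmersion t ht)
                (ν t) z)⁻¹) y -
            (((ofRiemannian h).inducedMetric (F t) hpb (Hc.isSpacelikeImmersion t ht)).normSq y
                ((ofRiemannian h).secondFundamentalForm (𝓡 2) (F t) (ν t) y) +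
              (ofRiemannian h).ricci (F t y) (ν t y) (ν t y)) /
            (ofRiemannian h).meanCurvature (F t) hpb (Hc.isSpacelikeImmersion t ht) (ν t) y) ∧
        -- Gauss–Bonnet with `χ ≤ 2`
        (∀ t (ht : t ∈ Set.Ioo a b),
          haveI := ((ofRiemannian h).inducedMetric (F t) hpb
            (Hc.isSpacelikeImmersion t ht)).hasLeviCivita
          ∫ y, ((ofRiemannian h).inducedMetric (F t) hpb
            (Hc.isSpacelikeImmersion t ht)).scalarCurvature y
          ∂(riemannianVolume ((ofRiemannian h).inducedRiemannianMetric (F t) hpb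
            (Hc.isSpacelikeImmersion t ht)) 2) ≤ 8 * π)) :
    geroch_monotonicity_smooth := by
  refine geroch_monotonicity_smooth_of_evolution ?_
  intro X _ _ _ _ _ h _ S _ _ _ _ _ _ _ _ hpb F ν a b Hc hR
  obtain ⟨Hf, hHf, hevol, hGB⟩ := hin X h S hpb F ν a b Hc hR
  exact ⟨Hf, hHf, fun y₀ ↦ (Hc.contDiffOn_meanCurvature_chart Hf hHf y₀).of_le
    (by exact_mod_cast le_top), hevol, hGB⟩

end Literature.Geometry.Lorentzian

end
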